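import Literature.MathematicalPhysics.KineticTheory.LangevinChainVariational
import Literature.MathematicalPhysics.KineticTheory.LangevinChainCostate
import Literature.Analysis.ODE.LinearObservability
import HarnessLib

/-!
# Bond–heat uncertainty window, part U-b: the harmonic chain is linear

Cell `decomp-a2c`, lineage crux `ExtensiveSnapshotIrreversibility` (K_fix half, leaf S3
`KernelTemperatureLipschitz`), HARMONIC CALIBRATION of the skeleton-weight leaf (SWM)
`SkeletonWeightMoments` (part R), step 2 of 4 (U-a: abstract sampling rate; U-b: this file; U-c:
costate sampling of the skeleton Gram form; U-d: the calibration theorem).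

The harmonic chain is the pinned chain `pinnedChain ω₂ 0 0 γ` (on-site `ω₂ q²/2`, coupling `r²/2`,
friction `γ` at the two ends).  Everything in this file is exact linear algebra / linear ODE:

* §1 its Hessian is constant, so the linearised drift `DY(x) = 𝒜` (`harmDriftLin`) and the
  co-drift `G(x) = 𝒢` (`harmCoDriftLin`, packaged as a continuous linear map) do not depend on the
  point, with the adjoint identity `⟨𝒢 c, v⟩ = -⟨c, 𝒜 v⟩` (`dualPair_harmCoDriftLin`), and the
  drift is affine: `Y(x) - Y(y) = 𝒜 (x - y)` (`harmonic_drift_sub`);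
* §2 the costate through `λ` at time `s`, `c_λ(t) = exp((t-s)𝒢) λ` (`harmCostate`), solves the
  costate equation `ċ = G(ζ(t)) c` along EVERY trajectory `ζ`, and the pairing `⟨c_λ(t), v(t)⟩` with
  any solution of `v̇ = 𝒜 v` is conserved (`dualPair_harmCostate_eq`); norm and oscillation bounds
  of the costate on `[0, s] ⊆ [0, 1]` (§3, from the Grönwall comparison of
  `LinearObservability.lean`, no series manipulations);
* §4 (needs `ω₂ > 0`, `γ ≥ 0` for the pathwise flow) the flow is affine in the starting point,
  `X^z_t - X^{z'}_t = exp(t𝒜)(z - z')` (`harmonic_chainFlow_sub`), hence `∂_z X^z_t = exp(t𝒜)`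
  (`harmonic_hasFDerivAt_chainFlow`), and the variational solution of `LangevinChainVariational`
  does not depend on the starting point, the base noise or the expansion point
  (`harmonic_variation_eqOn`): all solve the same linear Volterra equation.

No new instance / notation; no proof holes.  References: E. D. Sontag, *Mathematical Control
Theory* (1998), §3 (variation of constants, adjoint system); J.-P. Eckmann, C.-A. Pillet,
L. Rey-Bellet, Comm. Math. Phys. 201 (1999) 657, §3 (the harmonic chain as a linear SDE).
-/

noncomputable section

namespace Summit.AtomisticToContinuum.FouriersLaw.Theorems.ExtensiveSnapshotIrreversibility.EnergyWindow

open MeasureTheory Filter Topology Real unitInterval Set NormedSpace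
open scoped ContDiff
open Literature.MathematicalPhysics.KineticTheory.HeatConduction
open Literature.Analysis.ODE

/-! ## 0. A norm bound for linear flows -/

section Flow

variable {E : Type*} [NormedAddCommGroup E] [NormedSpace ℝ E] [CompleteSpace E]

/-- `‖exp(uA) X₀‖ ≤ ‖X₀‖ e^{‖A‖ u}` for `u ≥ 0` (Grönwall comparison with the zero solution).
[folklore] -/
theorem norm_linearFlow_le (A : E →L[ℝ] E) (X₀ : E) {u : ℝ} (hu : 0 ≤ u) :
    ‖exp (u • A) X₀‖ ≤ ‖X₀‖ * Real.exp (‖A‖ * u) := by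
  have hX : IsIntegralSolutionOn A (fun _ => (0 : E)) (fun _ => (0 : E)) u := by
    intro t _
    simp
  have h := hX.norm_sub_linearFlow_le (X₀ := X₀) (δ := ‖X₀‖) continuous_const
    (fun t _ => by rw [zero_sub, norm_neg]) u ⟨hu, le_rfl⟩
  rwa [zero_sub, norm_neg] at h

end Flow

/-! ## 1. Constant Hessian, linearised drift `𝒜`, co-drift `𝒢` -/

section Linear

variable (ω₂ γ : ℝ) (N : ℕ)

/-- `U'' = ω₂` for the harmonic pinning. [folklore] -/
theorem harmonic_deriv_deriv_U (q : ℝ) : deriv (deriv (pinnedChain ω₂ 0 0 γ).U) q = ω₂ := by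
  have h : deriv (pinnedChain ω₂ 0 0 γ).U = fun q => ω₂ * q := by
    funext q
    rw [pinnedChain_deriv_U]
    ring
  rw [h]
  exact (((hasDerivAt_id q).const_mul ω₂).deriv).trans (mul_one ω₂)

/-- `V'' = 1` for the harmonic coupling. [folklore] -/
theorem harmonic_deriv_deriv_V (r : ℝ) : deriv (deriv (pinnedChain ω₂ 0 0 γ).V) r = 1 := by
  rw [pinnedChain_deriv_deriv_V]
  ring

/-- **The Hessian of the harmonic potential is constant.** [folklore] -/
theorem harmonic_hessPotential_eq (i j : Fin N) (q : Fin N → ℝ) :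
    (pinnedChain ω₂ 0 0 γ).hessPotential N i j q =
      (pinnedChain ω₂ 0 0 γ).hessPotential N i j 0 := by
  simp only [OscillatorChain.hessPotential, harmonic_deriv_deriv_U, harmonic_deriv_deriv_V]

/-- `𝒜`: the linearised drift `DY(0)` of the harmonic chain, a continuous linear map of phase
space. [folklore] -/
def harmDriftLin : PhaseSpace N →L[ℝ] PhaseSpace N :=
  fderiv ℝ ((pinnedChain ω₂ 0 0 γ).drift N) 0

/-- **The linearised drift of the harmonic chain is the constant `𝒜`.** [folklore] -/
theorem harmonic_fderiv_drift (x : PhaseSpace N) :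
    fderiv ℝ ((pinnedChain ω₂ 0 0 γ).drift N) x = harmDriftLin ω₂ γ N := by
  refine ContinuousLinearMap.ext fun v => ?_
  unfold harmDriftLin
  rw [(pinnedChain ω₂ 0 0 γ).fderiv_drift_apply (pinnedChain_contDiff_U ω₂ 0 0 γ)
      (pinnedChain_contDiff_V ω₂ 0 0 γ),
    (pinnedChain ω₂ 0 0 γ).fderiv_drift_apply (pinnedChain_contDiff_U ω₂ 0 0 γ)
      (pinnedChain_contDiff_V ω₂ 0 0 γ)]
  simp only [harmonic_hessPotential_eq ω₂ γ N _ _ x.1, Prod.fst_zero]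

/-- The harmonic drift is differentiable. [folklore] -/
theorem harmonic_differentiable_drift : Differentiable ℝ ((pinnedChain ω₂ 0 0 γ).drift N) :=
  ((pinnedChain ω₂ 0 0 γ).contDiff_drift (pinnedChain_contDiff_U ω₂ 0 0 γ)
    (pinnedChain_contDiff_V ω₂ 0 0 γ) N).differentiable (by simp)

/-- **The harmonic drift is affine**: `Y(x) - Y(y) = 𝒜 (x - y)`. [folklore] -/
theorem harmonic_drift_sub (x y : PhaseSpace N) :
    (pinnedChain ω₂ 0 0 γ).drift N x - (pinnedChain ω₂ 0 0 γ).drift N y =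
      harmDriftLin ω₂ γ N (x - y) := by
  have hd := harmonic_differentiable_drift ω₂ γ N
  have hg : Differentiable ℝ (fun x => (pinnedChain ω₂ 0 0 γ).drift N x - harmDriftLin ω₂ γ N x) :=
    hd.sub (harmDriftLin ω₂ γ N).differentiable
  have hg' : ∀ x, fderiv ℝ (fun x => (pinnedChain ω₂ 0 0 γ).drift N x - harmDriftLin ω₂ γ N x) x
      = 0 := by
    intro x
    rw [fderiv_fun_sub (hd x) (harmDriftLin ω₂ γ N).differentiableAt, ContinuousLinearMap.fderiv,
      harmonic_fderiv_drift, sub_self]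
  have h := is_const_of_fderiv_eq_zero hg hg' x y
  rw [map_sub]
  exact sub_eq_sub_iff_sub_eq_sub.mpr h

/-- `𝒢`: the co-drift `G(0)` of the harmonic chain as a continuous linear map. [folklore] -/
def harmCoDriftLin : PhaseSpace N →L[ℝ] PhaseSpace N :=
  LinearMap.toContinuousLinearMap
    { toFun := fun c => (pinnedChain ω₂ 0 0 γ).coDrift N 0 c
      map_add' := fun c d => by
        ext j
        · simp [OscillatorChain.coDrift, add_mul, Finset.sum_add_distrib]
        · simp [OscillatorChain.coDrift]
          ring
      map_smul' := fun a c => by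
        ext j
        · simp [OscillatorChain.coDrift, Finset.mul_sum, mul_assoc]
        · simp [OscillatorChain.coDrift]
          ring }

/-- Unfolding `𝒢`. [folklore] -/
theorem harmCoDriftLin_apply (c : PhaseSpace N) :
    harmCoDriftLin ω₂ γ N c = (pinnedChain ω₂ 0 0 γ).coDrift N 0 c := rfl

/-- **The co-drift of the harmonic chain is the constant `𝒢`.** [folklore] -/
theorem harmonic_coDrift_eq (x c : PhaseSpace N) :
    (pinnedChain ω₂ 0 0 γ).coDrift N x c = harmCoDriftLin ω₂ γ N c := by
  rw [harmCoDriftLin_apply]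
  simp only [OscillatorChain.coDrift, harmonic_hessPotential_eq ω₂ γ N _ _ x.1, Prod.fst_zero]

/-- **Adjoint identity** `⟨𝒢 c, v⟩ = -⟨c, 𝒜 v⟩`. [folklore] -/
theorem dualPair_harmCoDriftLin (c v : PhaseSpace N) :
    dualPair (harmCoDriftLin ω₂ γ N c) v = -dualPair c (harmDriftLin ω₂ γ N v) :=
  (pinnedChain ω₂ 0 0 γ).dualPair_coDrift (pinnedChain_contDiff_U ω₂ 0 0 γ)
    (pinnedChain_contDiff_V ω₂ 0 0 γ) N 0 c v

/-! ## 2. The harmonic costate `c_λ(t) = exp((t - s)𝒢) λ` -/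

/-- The **harmonic costate** through `λ` at time `s`: `c_λ(t) = exp((t - s) 𝒢) λ`. [folklore] -/
def harmCostate (s : ℝ) (l : PhaseSpace N) (t : ℝ) : PhaseSpace N :=
  exp ((t - s) • harmCoDriftLin ω₂ γ N) l

/-- `c_λ(s) = λ`. [folklore] -/
theorem harmCostate_self (s : ℝ) (l : PhaseSpace N) : harmCostate ω₂ γ N s l s = l := by
  simp only [harmCostate, sub_self, zero_smul, NormedSpace.exp_zero]
  rfl

/-- **The costate solves `ċ = 𝒢 c`.** [folklore] -/
theorem hasDerivAt_harmCostate (s : ℝ) (l : PhaseSpace N) (t : ℝ) :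
    HasDerivAt (harmCostate ω₂ γ N s l) (harmCoDriftLin ω₂ γ N (harmCostate ω₂ γ N s l t)) t := by
  have h := (hasDerivAt_linearFlow (harmCoDriftLin ω₂ γ N) l (t - s)).scomp t
    ((hasDerivAt_id t).sub_const s)
  rw [one_smul] at h
  have hfun : harmCostate ω₂ γ N s l =
      (fun u => exp (u • harmCoDriftLin ω₂ γ N) l) ∘ fun x => x - s := rfl
  rw [hfun]
  exact h

/-- **The costate solves the costate equation `ċ = G(ζ(t)) c` along every trajectory `ζ`** (the
co-drift being constant). [folklore] -/
theorem hasDerivAt_harmCostate_coDrift (x : PhaseSpace N) (s : ℝ) (l : PhaseSpace N) (t : ℝ) :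
    HasDerivAt (harmCostate ω₂ γ N s l)
      ((pinnedChain ω₂ 0 0 γ).coDrift N x (harmCostate ω₂ γ N s l t)) t := by
  rw [harmonic_coDrift_eq]
  exact hasDerivAt_harmCostate ω₂ γ N s l t

/-- The costate is continuous in time. [folklore] -/
theorem continuous_harmCostate (s : ℝ) (l : PhaseSpace N) :
    Continuous (harmCostate ω₂ γ N s l) := by
  change Continuous fun t => exp ((t - s) • harmCoDriftLin ω₂ γ N) l
  exact (continuous_linearFlow (harmCoDriftLin ω₂ γ N) l).comp (continuous_sub_right s)

/-- **Conservation of the pairing**: for every solution of `v̇ = 𝒜 v`, `⟨c_λ(t), v(t)⟩ = ⟨λ, v(s)⟩`.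
[folklore] -/
theorem dualPair_harmCostate_eq {v : ℝ → PhaseSpace N}
    (hv : ∀ t, HasDerivAt v (harmDriftLin ω₂ γ N (v t)) t) (s : ℝ) (l : PhaseSpace N) (t : ℝ) :
    dualPair (harmCostate ω₂ γ N s l t) (v t) = dualPair l (v s) := by
  have hF : ∀ u, HasDerivAt (fun u => dualPair (harmCostate ω₂ γ N s l u) (v u)) 0 u := by
    intro u
    have h := hasDerivAt_dualPair (hasDerivAt_harmCostate ω₂ γ N s l u) (hv u)
    rw [dualPair_harmCoDriftLin, neg_add_cancel] at h
    exact h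
  have hdiff : Differentiable ℝ (fun u => dualPair (harmCostate ω₂ γ N s l u) (v u)) :=
    fun u => (hF u).differentiableAt
  have hconst := is_const_of_deriv_eq_zero hdiff (fun u => (hF u).deriv) t s
  have h' : dualPair (harmCostate ω₂ γ N s l s) (v s) = dualPair l (v s) := by
    rw [harmCostate_self]
  exact hconst.trans h'

/-- **Duality with the linearised flow**: `⟨λ, exp(s𝒜) v₀⟩ = ⟨c_λ(0), v₀⟩`. [folklore] -/
theorem dualPair_exp_harmDriftLin (s : ℝ) (l v₀ : PhaseSpace N) :
    dualPair l (exp (s • harmDriftLin ω₂ γ N) v₀) = dualPair (harmCostate ω₂ γ N s l 0) v₀ := by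
  have h := dualPair_harmCostate_eq ω₂ γ N (v := fun t => exp (t • harmDriftLin ω₂ γ N) v₀)
    (fun t => hasDerivAt_linearFlow (harmDriftLin ω₂ γ N) v₀ t) s l 0
  simp only [linearFlow_zero] at h
  exact h.symm

/-! ## 3. Norm and oscillation bounds of the costate on `[0, s] ⊆ [0, 1]` -/

/-- `‖c_λ(t)‖ ≤ ‖λ‖ e^{‖𝒢‖ (s - t)}` for `t ≤ s`. [folklore] -/
theorem norm_harmCostate_le {s t : ℝ} (hts : t ≤ s) (l : PhaseSpace N) :
    ‖harmCostate ω₂ γ N s l t‖ ≤ ‖l‖ * Real.exp (‖harmCoDriftLin ω₂ γ N‖ * (s - t)) := by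
  have h := norm_linearFlow_le (-harmCoDriftLin ω₂ γ N) l (sub_nonneg.2 hts)
  rw [norm_neg] at h
  have he : (s - t) • (-harmCoDriftLin ω₂ γ N) = (t - s) • harmCoDriftLin ω₂ γ N := by
    rw [smul_neg, ← neg_smul, neg_sub]
  rw [he] at h
  exact h

/-- `‖c_λ(t)‖ ≤ ‖λ‖ e^{‖𝒢‖}` for `0 ≤ t ≤ s ≤ 1`. [folklore] -/
theorem norm_harmCostate_le_of_mem {s t : ℝ} (hs : s ≤ 1) (ht : t ∈ Icc 0 s) (l : PhaseSpace N) :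
    ‖harmCostate ω₂ γ N s l t‖ ≤ ‖l‖ * Real.exp ‖harmCoDriftLin ω₂ γ N‖ := by
  refine (norm_harmCostate_le ω₂ γ N ht.2 l).trans (mul_le_mul_of_nonneg_left ?_ (norm_nonneg _))
  exact Real.exp_le_exp.2 (mul_le_of_le_one_right (norm_nonneg _) (by linarith [ht.1]))

/-- A momentum component of a phase-space vector is bounded by its norm. [folklore] -/
theorem abs_snd_apply_le_norm (w : PhaseSpace N) (b : Fin N) : |w.2 b| ≤ ‖w‖ := by
  rw [← Real.norm_eq_abs]
  exact (norm_le_pi_norm w.2 b).trans (norm_snd_le w)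

/-- The bath-momentum component `β_λ(t) = (c_λ(t)).2 b` of the costate has derivative
`(𝒢 c_λ(t)).2 b`. [folklore] -/
theorem hasDerivAt_harmCostate_snd (s : ℝ) (l : PhaseSpace N) (b : Fin N) (t : ℝ) :
    HasDerivAt (fun u => (harmCostate ω₂ γ N s l u).2 b)
      ((harmCoDriftLin ω₂ γ N (harmCostate ω₂ γ N s l t)).2 b) t := by
  have hL := ((ContinuousLinearMap.proj b :
      (Fin N → ℝ) →L[ℝ] ℝ).comp (ContinuousLinearMap.snd ℝ (Fin N → ℝ) (Fin N → ℝ))).hasFDerivAt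
      |>.comp_hasDerivAt t (hasDerivAt_harmCostate ω₂ γ N s l t)
  exact hL

/-- The bath-momentum component of the costate is continuous. [folklore] -/
theorem continuous_harmCostate_snd (s : ℝ) (l : PhaseSpace N) (b : Fin N) :
    Continuous fun u => (harmCostate ω₂ γ N s l u).2 b :=
  (continuous_apply b).comp (continuous_snd.comp (continuous_harmCostate ω₂ γ N s l))

/-- **Oscillation bound**: on `[0, s] ⊆ [0, 1]` the bath-momentum component of the costate is
Lipschitz with constant `‖𝒢‖ ‖λ‖ e^{‖𝒢‖}`. [folklore] -/
theorem abs_harmCostate_snd_sub_le {s : ℝ} (hs : s ≤ 1) (l : PhaseSpace N) (b : Fin N)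
    {t u : ℝ} (ht : t ∈ Icc 0 s) (hu : u ∈ Icc 0 s) :
    |(harmCostate ω₂ γ N s l t).2 b - (harmCostate ω₂ γ N s l u).2 b| ≤
      ‖harmCoDriftLin ω₂ γ N‖ * (‖l‖ * Real.exp ‖harmCoDriftLin ω₂ γ N‖) * |t - u| := by
  have hder : ∀ x ∈ Icc 0 s, HasDerivWithinAt (fun u => (harmCostate ω₂ γ N s l u).2 b)
      ((harmCoDriftLin ω₂ γ N (harmCostate ω₂ γ N s l x)).2 b) (Icc 0 s) x :=
    fun x _ => (hasDerivAt_harmCostate_snd ω₂ γ N s l b x).hasDerivWithinAt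
  have hbound : ∀ x ∈ Icc 0 s, ‖(harmCoDriftLin ω₂ γ N (harmCostate ω₂ γ N s l x)).2 b‖ ≤
      ‖harmCoDriftLin ω₂ γ N‖ * (‖l‖ * Real.exp ‖harmCoDriftLin ω₂ γ N‖) := by
    intro x hx
    rw [Real.norm_eq_abs]
    refine (abs_snd_apply_le_norm N _ b).trans ?_
    refine ((harmCoDriftLin ω₂ γ N).le_opNorm _).trans ?_
    exact mul_le_mul_of_nonneg_left (norm_harmCostate_le_of_mem ω₂ γ N hs hx l) (norm_nonneg _)
  have h := (convex_Icc 0 s).norm_image_sub_le_of_norm_hasDerivWithin_le hder hbound hu ht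
  rw [Real.norm_eq_abs, Real.norm_eq_abs] at h
  exact h

end Linear

/-! ## 4. The harmonic flow is affine in the starting point; the variation is universal -/

section FlowAffine

variable {ω₂ γ : ℝ} (hω : 0 < ω₂) (hγ : 0 ≤ γ) (N : ℕ)

include hω hγ

/-- **The harmonic flow is affine in the starting point**: `X^z_t - X^{z'}_t = exp(t𝒜)(z - z')` for
`t ∈ [0, T]` and every continuous noise path (both sides solve the same linear Volterra equation;
Grönwall uniqueness). [folklore] -/
theorem harmonic_chainFlow_sub (z z' : PhaseSpace N) {η : ℝ → Fin N → ℝ} (hη : Continuous η)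
    {T t : ℝ} (ht : t ∈ Icc 0 T) :
    (pinnedChain ω₂ 0 0 γ).chainFlow N z η t - (pinnedChain ω₂ 0 0 γ).chainFlow N z' η t =
      exp (t • harmDriftLin ω₂ γ N) (z - z') := by
  have h1 := pinnedChain_isIntegralSolutionOn_chainFlow hω le_rfl le_rfl hγ N z hη T
  have h2 := pinnedChain_isIntegralSolutionOn_chainFlow hω le_rfl le_rfl hγ N z' hη T
  have hc1 := pinnedChain_continuous_chainFlow hω le_rfl le_rfl hγ N z hη
  have hc2 := pinnedChain_continuous_chainFlow hω le_rfl le_rfl hγ N z' hη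
  have hdc : Continuous ((pinnedChain ω₂ 0 0 γ).drift N) :=
    (harmonic_differentiable_drift ω₂ γ N).continuous
  have hD : IsIntegralSolutionOn (harmDriftLin ω₂ γ N) (fun _ => z - z')
      (fun t => (pinnedChain ω₂ 0 0 γ).chainFlow N z η t -
        (pinnedChain ω₂ 0 0 γ).chainFlow N z' η t) T := by
    intro u hu
    have hi1 : IntervalIntegrable (fun r => (pinnedChain ω₂ 0 0 γ).drift N
        ((pinnedChain ω₂ 0 0 γ).chainFlow N z η r)) volume 0 u :=
      (hdc.comp hc1).intervalIntegrable _ _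
    have hi2 : IntervalIntegrable (fun r => (pinnedChain ω₂ 0 0 γ).drift N
        ((pinnedChain ω₂ 0 0 γ).chainFlow N z' η r)) volume 0 u :=
      (hdc.comp hc2).intervalIntegrable _ _
    show (pinnedChain ω₂ 0 0 γ).chainFlow N z η u - (pinnedChain ω₂ 0 0 γ).chainFlow N z' η u =
      (z - z') + ∫ r in (0 : ℝ)..u, harmDriftLin ω₂ γ N ((pinnedChain ω₂ 0 0 γ).chainFlow N z η r -
        (pinnedChain ω₂ 0 0 γ).chainFlow N z' η r)
    rw [h1 u hu, h2 u hu, add_sub_add_comm, OscillatorChain.forcing_sub_forcing,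
      ← intervalIntegral.integral_sub hi1 hi2]
    congr 1
    refine intervalIntegral.integral_congr fun r _ => ?_
    exact harmonic_drift_sub ω₂ γ N _ _
  have hE := isIntegralSolutionOn_linearFlow (harmDriftLin ω₂ γ N) (z - z') T
  exact IsIntegralSolutionOn.eqOn_of_lipschitzOnWith (S := univ)
    (harmDriftLin ω₂ γ N).lipschitz.lipschitzOnWith hD hE (hc1.sub hc2)
    (continuous_linearFlow _ _) (fun _ _ => mem_univ _) (fun _ _ => mem_univ _) ht

/-- `X^z_t = X^0_t + exp(t𝒜) z`. [folklore] -/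
theorem harmonic_chainFlow_eq_add (z : PhaseSpace N) {η : ℝ → Fin N → ℝ} (hη : Continuous η)
    {T t : ℝ} (ht : t ∈ Icc 0 T) :
    (pinnedChain ω₂ 0 0 γ).chainFlow N z η t =
      (pinnedChain ω₂ 0 0 γ).chainFlow N 0 η t + exp (t • harmDriftLin ω₂ γ N) z := by
  have h := harmonic_chainFlow_sub hω hγ N z 0 hη ht
  rw [sub_zero] at h
  exact sub_eq_iff_eq_add'.1 h

/-- **`∂_z X^z_t = exp(t𝒜)`**: the harmonic flow at time `t ∈ [0, T]` is differentiable in the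
starting point with derivative the linearised flow. [folklore] -/
theorem harmonic_hasFDerivAt_chainFlow {η : ℝ → Fin N → ℝ} (hη : Continuous η) {T t : ℝ}
    (ht : t ∈ Icc 0 T) (z : PhaseSpace N) :
    HasFDerivAt (fun z' => (pinnedChain ω₂ 0 0 γ).chainFlow N z' η t)
      (exp (t • harmDriftLin ω₂ γ N)) z := by
  have hfun : (fun z' => (pinnedChain ω₂ 0 0 γ).chainFlow N z' η t) = fun z' =>
      (pinnedChain ω₂ 0 0 γ).chainFlow N 0 η t + exp (t • harmDriftLin ω₂ γ N) z' :=
    funext fun z' => harmonic_chainFlow_eq_add hω hγ N z' hη ht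
  rw [hfun]
  exact (exp (t • harmDriftLin ω₂ γ N)).hasFDerivAt.const_add _

/-- `fderiv` form of `harmonic_hasFDerivAt_chainFlow`. [folklore] -/
theorem harmonic_fderiv_chainFlow {η : ℝ → Fin N → ℝ} (hη : Continuous η) {T t : ℝ}
    (ht : t ∈ Icc 0 T) (z : PhaseSpace N) :
    fderiv ℝ (fun z' => (pinnedChain ω₂ 0 0 γ).chainFlow N z' η t) z =
      exp (t • harmDriftLin ω₂ γ N) :=
  (harmonic_hasFDerivAt_chainFlow hω hγ N hη ht z).fderiv

/-- The variational solution of the harmonic chain solves the LINEAR Volterra equation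
`w(τ) = (0, (Hδ)(τ)) + ∫₀^τ 𝒜 w` on `[0, 1]`, whatever the starting point, base noise and expansion
point. [folklore] -/
theorem harmonic_isIntegralSolutionOn_variation {X : Type} [NormedAddCommGroup X]
    [NormedSpace ℝ X] [CompleteSpace X] (z : PhaseSpace N) {η₀ : ℝ → Fin N → ℝ}
    (hη₀ : Continuous η₀) (H : X →L[ℝ] C(I, Fin N → ℝ)) (x δ : X) :
    IsIntegralSolutionOn (harmDriftLin ω₂ γ N)
      (fun τ => (((0 : Fin N → ℝ), IccExtend zero_le_one (H δ) τ) : PhaseSpace N))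
      (pinnedChainVariation hω le_rfl le_rfl hγ N z hη₀ H x δ) 1 := by
  intro τ hτ
  show _ = (((0 : Fin N → ℝ), IccExtend zero_le_one (H δ) τ) : PhaseSpace N) +
    ∫ u in (0 : ℝ)..τ,
      harmDriftLin ω₂ γ N (pinnedChainVariation hω le_rfl le_rfl hγ N z hη₀ H x δ u)
  rw [pinnedChainVariation_eq hω le_rfl le_rfl hγ N z hη₀ H x δ hτ, IccExtend_of_mem _ _ hτ]
  congr 1
  refine intervalIntegral.integral_congr fun u _ => ?_
  simp only [harmonic_fderiv_drift]

/-- **The harmonic variational solution is universal**: it does not depend on the starting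
point, the base noise path or the expansion point (uniqueness for the linear Volterra equation).
[folklore] -/
theorem harmonic_variation_eqOn {X : Type} [NormedAddCommGroup X] [NormedSpace ℝ X]
    [CompleteSpace X] (z z' : PhaseSpace N) {η₀ η₀' : ℝ → Fin N → ℝ} (hη₀ : Continuous η₀)
    (hη₀' : Continuous η₀') (H : X →L[ℝ] C(I, Fin N → ℝ)) (x x' δ : X) :
    EqOn (pinnedChainVariation hω le_rfl le_rfl hγ N z hη₀ H x δ)
      (pinnedChainVariation hω le_rfl le_rfl hγ N z' hη₀' H x' δ) (Icc 0 1) :=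
  IsIntegralSolutionOn.eqOn_of_lipschitzOnWith (S := univ)
    (harmDriftLin ω₂ γ N).lipschitz.lipschitzOnWith
    (harmonic_isIntegralSolutionOn_variation hω hγ N z hη₀ H x δ)
    (harmonic_isIntegralSolutionOn_variation hω hγ N z' hη₀' H x' δ)
    (continuous_pinnedChainVariation hω le_rfl le_rfl hγ N z hη₀ H x δ)
    (continuous_pinnedChainVariation hω le_rfl le_rfl hγ N z' hη₀' H x' δ)
    (fun _ _ => mem_univ _) (fun _ _ => mem_univ _)

end FlowAffine

end Summit.AtomisticToContinuum.FouriersLaw.Theorems.ExtensiveSnapshotIrreversibility.EnergyWindow
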